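import Literature.MathematicalPhysics.KineticTheory.FouriersLaw
import Mathlib.Probability.Kernel.Invariance
import Mathlib.Probability.Kernel.Composition.Comp
import Mathlib.MeasureTheory.Integral.IntervalIntegral.Basic
import Mathlib.MeasureTheory.Measure.Lebesgue.Basic
import Mathlib.Analysis.SpecialFunctions.Exp
import Mathlib.Analysis.SpecialFunctions.Pow.Real
import Mathlib.Analysis.Calculus.IteratedDeriv.Defs
import Mathlib.Analysis.Calculus.ContDiff.Operations
import Mathlib.Analysis.Real.Sqrt
import HarnessLib

/-!
# Rey-Bellet–Thomas 2002: exponential convergence to the NESS of an anharmonic chain coupled to two free-phonon reservoirs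

Topic `Literature/MathematicalPhysics/KineticTheory` (trunk T-KINETIC); `litbuild` for the statement
source `ReyBelletThomas2002` of the sub-problem `AtomisticToContinuum/FouriersLaw`: existence,
uniqueness and exponential mixing of the stationary state of a RELATED model — the chain coupled to
free-phonon (wave-equation) reservoirs, reduced to the Markovian system (RBT-SDE) on the EXTENDED
phase space `RBPhaseSpace N`. The conjunct `Literature.MathematicalPhysics.KineticTheory.HeatConduction.FouriersLaw` is about the
Langevin-bath chain (`OscillatorChain.generator` on `PhaseSpace N`); its printed NESS theory is
`CuneoEckmannHairerReyBellet2018_thm213` (`LangevinSemigroup.lean`). Nothing here discharges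
conjunct (i) of `FouriersLawFor`.

## Source

L. Rey-Bellet, L. E. Thomas, *Exponential convergence to non-equilibrium stationary states in
classical statistical mechanics*, Comm. Math. Phys. **225** (2002) 305–329 (arXiv:math-ph/0110024),
§1 (hypotheses **H1**–**H2**), §2 (the effective Markovian equations in compact form — arXiv label
`(e23)`, called "(RBT-SDE)" below — and the display defining their generator `L`) and
**Theorem 2.1**; printed equation numbers of RBT are not used as locators (section, theorem number
and arXiv labels only, checked against arXiv:math-ph/0110024), the equation-level locators are those
of the `d = 1` restatement: the one-dimensional (`d = 1`) reading of **H1**–**H2** is the one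
printed in L. Rey-Bellet, *Open classical systems*, Lecture Notes in Math. **1881** (2006) 41–78, §3
eqs. (64)–(67) and Theorem 3.1. The model goes back to Eckmann–Pillet–Rey-Bellet, Comm. Math. Phys.
**201** (1999) 657–697 (arXiv:chao-dyn/9804001), whose theorems (quadratic-plus-bounded potentials,
small coupling) are vendored separately.

## The model (RBT 2002, §1–§2)

A chain of `n` oscillators `H_S(p,q) = ∑ p_i²/2 + V(q)`, `V(q) = ∑_i U⁽¹⁾(q_i) + ∑_i U⁽²⁾(q_i - q_{i+1})`,
whose first and last particles are coupled (dipole coupling, charge densities with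
`|ρ̂(k)|² ∝ (k² + γ²)⁻¹`) to two free scalar fields at temperatures `T_1 = T_L`, `T_n = T_R`.
Integrating out the fields and adding ONE auxiliary variable per reservoir, `r = (r_1, r_n) ∈ ℝ²`,
gives the Markovian system (RBT-SDE) (RB 2006 eq. (69))
`q̇ = p`, `ṗ = -∇_q V - Λᵀ r`, `dr = (-γ r + Λ p) dt + (2γT)^{1/2} dω`,
`Λ(x_1,…,x_n) = (λ x_1, λ x_n)`, `T = diag(T_1, T_n)`, on `X = ℝ^{2(n+1)}` (`d = 1`), with generator
(RB 2006 eq. (71))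
`L = γ(∇_r T ∇_r - r ∇_r) + (Λp ∇_r - r Λ ∇_p) + (p ∇_q - ∇_q V ∇_p)`
and energy `G(p,q,r) = r²/2 + H(p,q)`; "in the special case `T_1 = T_n = T`, `Z⁻¹ e^{-G/T}` is an
invariant measure". (RBT rename the renormalised potential `V_eff = V - λ²q_1²/2 - λ²q_n²/2` to `V`
"from now on"; Theorem 2.1 is about (RBT-SDE) with H1–H2 for the potential appearing there, and that is
how it is vendored.)

## Contents

* `MarkovSemigroupFor L` — hypothesis structure (generic in the state space `X` and the generator
  `L` on `C_c^∞`): a measurable Markov semigroup of kernels `P_t` with `P_0 = id`,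
  Chapman–Kolmogorov, and Dynkin's identity `P_t f - f = ∫₀ᵗ P_s (L f) ds` for `f ∈ C_c^∞`
  ("`T^t f(x) = E_x[f(x(t))]` with generator `L`", RBT §2). Same shape as
  `LangevinChainSemigroup` of `LangevinSemigroup.lean` (which is the special case
  `L = OscillatorChain.generator P N T_L T_R`); `act`, `IsInvariant` API. FOLLOW-UP (librarian
  refactor, recorded on the ledger note of this proposal): make `LangevinChainSemigroup P N T_L T_R`
  an `abbrev` for `MarkovSemigroupFor (P.generator N T_L T_R)` and delete its copied API; until
  then the API lemmas below duplicate `LangevinSemigroup.lean:126-181` with `L` generic.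
* `HasSmoothPosDensity μ` — `μ = ρ · Leb`, `ρ` smooth and everywhere positive.
* `RBPhaseSpace N = PhaseSpace N × (ℝ × ℝ)` (points `((q, p), (r_L, r_R))`), coordinate partial
  derivatives `rbPartialQ/rbPartialP/partialRL/partialRR`, `OscillatorChain.rbGenerator P Λ N T_L T_R`
  (RBT §2 / RB 2006 (71), for the chain data `P = (U, V, γ)` of `FouriersLaw.lean`, coupling `Λ = λ`),
  `OscillatorChain.rbEnergy` (`G`).
* Hypotheses: `RBGrowth W k` (H1 for a one-variable potential, RB 2006 (64)–(66), leading
  coefficient `a > 0`), `RBNondegenerate W` (H2, `d = 1`: "for any `q` there is `m ≥ 2` with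
  `∂^m U⁽²⁾(q) ≠ 0`").
* NAMED FACTS: `ReyBelletThomas2002_thm21` (Theorem 2.1, packaged existentially over the interface,
  exactly as `CuneoEckmannHairerReyBellet2018_thm213` is), `ReyBelletThomas2002_equilibrium` (the Gibbs
  density `e^{-G/T}` is stationary at `T_L = T_R = T`, weak form `∫ (Lf) e^{-G/T} = 0`).
* PROVED: the quartic potentials `c₂ y²/2 + c₄ y⁴/4` (`c₂ ≥ 0`, `c₄ > 0`) satisfy H1 with `k = 4`
  and H2 (`rbGrowth_quartic`, `rbNondegenerate_quartic`); hence the corollary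
  `ReyBelletThomas2002_thm21.pinnedChain`: for `pinnedChain ω₂ lam β γ` (`ω₂, lam, β, γ > 0`) coupled
  to Rey-Bellet–Thomas reservoirs there is a semigroup with exactly one invariant probability
  measure (for `N ≥ 2`, `ω₂ ≥ 0`).

## What is NOT vendored

* RBT Theorem 1.1 (law of large numbers and exponential convergence for the full Hamiltonian
  system chain + fields, for Gibbs-almost every field initial condition): needs the infinite-
  dimensional reservoir dynamics, not in the tree.
* The Langevin limit `C(t) → η²δ(t)` (RBT §2, the Langevin display): "Our techniques apply equally well to any of the
  couplings above. However, for simplicity, we will only consider the case … `|ρ_i(k)|² ∝ k² + γ²`"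
  — Theorem 2.1 is PRINTED only for (RBT-SDE); the Langevin-bath version is Carmona 2007 /
  Cuneo–Eckmann–Hairer–Rey-Bellet 2018 (`LangevinSemigroup.lean`).

## Design choices

* `d = 1` only (the conjunct's chains are one-dimensional); the growth exponents `k₁, k₂` are REAL
  numbers `≥ 2` as in print (no integrality); H1 (65) is taken in the RBT vector form
  `a k |x|^{k-2} x` (RB 2006 (65) prints `a k |x|^{k-1}`, a misprint for negative `x`); in (66) the
  base `C + D W(x)` is required nonnegative (real powers of negative bases are junk in Mathlib) —
  a harmless strengthening of the hypothesis; the leading coefficient `a` is required positive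
  ("grow at infinity like `|x|^k`"; with `a = 0` the zero potential would qualify).
* The tree's `OscillatorChain.hamiltonian` couples neighbours through `V(q_{i+1} - q_i)`, RBT through
  `U⁽²⁾(q_i - q_{i+1})`, i.e. `U⁽²⁾(x) = V(-x)`; H1 and H2 are invariant under `x ↦ -x`, so they are
  imposed on `P.V` directly.
* Sites: the left reservoir acts on the site `i` with `i.val = 0`, the right one on `i.val = N - 1`
  (the definitions make sense for `N = 1`, both reservoirs on one site, `Λx = (λx_1, λx_1)`, but the
  printed system indexes `j = 2, …, n - 1` with distinct `q_1, q_n`, so the FACTS require `N ≥ 2`).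
* "Unique invariant measure" = unique invariant PROBABILITY measure (stationary distribution,
  RB 2006 Thm 3.1 (a)). The weighted total-variation bound (RB 2006 (81)) is stated for measurable `f` with
  `|f| ≤ e^{θG}`; the finiteness of `μ(e^{θG})` and `P_t e^{θG}(x)` implicit in the operator-norm
  form "‖T^t - μ‖_θ ≤ R r^{-t}" (RB 2006 (82)) is made explicit, so that the Bochner integrals are honest.
* WHY `∃ S`: as in `LangevinSemigroup.lean` — the interface is satisfied by the transition semigroup
  of (RBT-SDE) but not proved to characterise it, so "for every `S`" could be stronger than print.
-/

noncomputable section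

open MeasureTheory ProbabilityTheory Filter Topology
open scoped ContDiff NNReal ENNReal

namespace Literature.MathematicalPhysics.KineticTheory.HeatConduction

/-! ### A generic interface: Markov semigroups with a prescribed generator on `C_c^∞` -/

/-- A **measurable Markov semigroup with generator `L` on smooth compactly supported functions** on
the state space `X`: transition kernels `P_t(z, ·)`, `t ≥ 0`, which are Markov kernels, jointly
measurable in `(t, z)`, with `P_0 = id`, the Chapman–Kolmogorov law `P_{s+t} = P_t ∘ₖ P_s`, and
Dynkin's identity `P_t f(z) - f(z) = ∫₀ᵗ P_s(L f)(z) ds` for `f ∈ C_c^∞(X)` (Itô's formula for an SDE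
with smooth coefficients and generator `L`). A hypothesis structure ("`T^t f(x) = E_x[f(x(t))]`, with
generator `L`", RBT 2002 §2); the transition semigroup of the SDE is such an object, its
existence for a given model is part of the corresponding named fact.
[cite: ReyBelletThomas2002, §2 (semigroup T^t and generator L)] [cite: ReyBellet2006, §3 eqs. (70)–(71)] -/
structure MarkovSemigroupFor {X : Type*} [MeasurableSpace X] [NormedAddCommGroup X]
    [NormedSpace ℝ X] (L : (X → ℝ) → X → ℝ) where
  /-- the transition kernels `P_t(z, ·)`, `t ≥ 0` -/
  kernel : ℝ≥0 → Kernel X X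
  /-- each `P_t` is a Markov (probability) kernel -/
  isMarkovKernel (t : ℝ≥0) : IsMarkovKernel (kernel t)
  /-- `P_0(z, ·) = δ_z` -/
  kernel_zero : kernel 0 = Kernel.id
  /-- Chapman–Kolmogorov: `P_{s+t} = P_t ∘ₖ P_s` -/
  kernel_add (s t : ℝ≥0) : kernel (s + t) = kernel t ∘ₖ kernel s
  /-- joint measurability of `(t, z) ↦ P_t(z, ·)` -/
  measurable_kernel : Measurable fun p : ℝ≥0 × X => kernel p.1 p.2
  /-- Dynkin's formula on `C_c^∞`: `P_t f(z) - f(z) = ∫₀ᵗ P_s(L f)(z) ds` -/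
  dynkin (f : X → ℝ) (hf : ContDiff ℝ ∞ f) (hf' : HasCompactSupport f) (t : ℝ≥0) (z : X) :
    ∫ y, f y ∂(kernel t z) - f z = ∫ s in (0 : ℝ)..(t : ℝ), ∫ y, L f y ∂(kernel s.toNNReal z)

namespace MarkovSemigroupFor

attribute [instance] isMarkovKernel

variable {X : Type*} [MeasurableSpace X] [NormedAddCommGroup X] [NormedSpace ℝ X]
  {L : (X → ℝ) → X → ℝ} (S : MarkovSemigroupFor L)

/-- The action on observables, `P_t f(z) = ∫ f(z') P_t(z, dz') = E_z f(z_t)` (RBT 2002, before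
§2: "`T^t f(x) = E_x[f(x(t))]`"). [cite: ReyBelletThomas2002, §2 (semigroup T^t)] [cite: ReyBellet2006, §3 eq. (70)] -/
def act (t : ℝ≥0) (f : X → ℝ) (z : X) : ℝ :=
  ∫ y, f y ∂(S.kernel t z)

/-- Unfolding `act`. [folklore] -/
theorem act_apply (t : ℝ≥0) (f : X → ℝ) (z : X) : S.act t f z = ∫ y, f y ∂(S.kernel t z) := rfl

/-- `P_0(z, ·) = δ_z`. [folklore] -/
@[simp] theorem kernel_zero_apply (z : X) : S.kernel 0 z = Measure.dirac z := by
  rw [S.kernel_zero, Kernel.id_apply]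

/-- `P_0 f = f` for measurable state spaces with measurable singletons (strong measurability of
`f` is not needed for the Dirac integral then). [folklore] -/
@[simp] theorem act_zero [MeasurableSingletonClass X] (f : X → ℝ) : S.act 0 f = f := by
  funext z
  rw [act_apply, kernel_zero_apply, integral_dirac]

/-- Chapman–Kolmogorov pointwise: `P_{s+t}(z, ·) = (P_s(z, ·)).bind P_t`. [folklore] -/
theorem kernel_add_apply (s t : ℝ≥0) (z : X) :
    S.kernel (s + t) z = (S.kernel s z).bind (S.kernel t) := by
  rw [S.kernel_add, Kernel.comp_apply]

/-- `P_t 1 = 1` (conservation of probability). [folklore] -/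
@[simp] theorem act_const (t : ℝ≥0) (c : ℝ) : S.act t (fun _ => c) = fun _ => c := by
  funext z
  simp [act_apply]

/-- Dynkin's formula in the `act` spelling. [cite: ReyBelletThomas2002, §2 (generator L)] -/
theorem act_sub_self (f : X → ℝ) (hf : ContDiff ℝ ∞ f) (hf' : HasCompactSupport f)
    (t : ℝ≥0) (z : X) :
    S.act t f z - f z = ∫ s in (0 : ℝ)..(t : ℝ), S.act s.toNNReal (L f) z :=
  S.dynkin f hf hf' t z

/-- `μ` is an **invariant measure** of the semigroup: `μ P_t = μ` for all `t ≥ 0` (Mathlib's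
`Kernel.Invariant`). [cite: ReyBelletThomas2002, Thm 2.1] -/
def IsInvariant (μ : Measure X) : Prop :=
  ∀ t : ℝ≥0, Kernel.Invariant (S.kernel t) μ

/-- Unfolding `IsInvariant`. [folklore] -/
theorem isInvariant_iff (μ : Measure X) :
    S.IsInvariant μ ↔ ∀ t : ℝ≥0, μ.bind (S.kernel t) = μ := Iff.rfl

/-- An invariant measure gives every measurable set the mass `μ(A) = ∫ P_t(z, A) μ(dz)`.
[folklore] -/
theorem IsInvariant.lintegral_kernel {μ : Measure X} (h : S.IsInvariant μ)
    (t : ℝ≥0) {A : Set X} (hA : MeasurableSet A) :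
    ∫⁻ z, S.kernel t z A ∂μ = μ A := by
  conv_rhs => rw [← h t]
  rw [Measure.bind_apply hA (S.kernel t).measurable.aemeasurable]

/-- The zero measure is (trivially) invariant; the facts concern invariant PROBABILITY measures.
[folklore] -/
theorem isInvariant_zero : S.IsInvariant 0 := fun _ => by
  simp [Kernel.Invariant]

end MarkovSemigroupFor

/-- `μ` has a **smooth, everywhere positive density** with respect to Lebesgue measure:
`μ = ρ · Leb`, `ρ ∈ C^∞`, `ρ > 0` (RBT 2002, Thm 2.1: "`μ` has a `C^∞` everywhere positive
density"). [cite: ReyBelletThomas2002, Thm 2.1] -/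
def HasSmoothPosDensity {X : Type*} [NormedAddCommGroup X] [NormedSpace ℝ X] [MeasureSpace X]
    (μ : Measure X) : Prop :=
  ∃ ρ : X → ℝ, ContDiff ℝ ∞ ρ ∧ (∀ x, 0 < ρ x) ∧
    μ = (volume : Measure X).withDensity fun x => ENNReal.ofReal (ρ x)

/-- A measure with a smooth positive density is absolutely continuous with respect to Lebesgue
measure. [folklore] -/
theorem HasSmoothPosDensity.absolutelyContinuous {X : Type*} [NormedAddCommGroup X]
    [NormedSpace ℝ X] [MeasureSpace X] {μ : Measure X} (h : HasSmoothPosDensity μ) :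
    μ ≪ (volume : Measure X) := by
  obtain ⟨ρ, -, -, rfl⟩ := h
  exact withDensity_absolutelyContinuous _ _

/-! ### The Rey-Bellet–Thomas effective model (`d = 1`, one auxiliary variable per reservoir) -/

/-- Extended phase space of the `N`-site chain coupled to two Rey-Bellet–Thomas reservoirs:
points `((q, p), (r_L, r_R))` with `(q, p) ∈ PhaseSpace N` and the two auxiliary reservoir
variables `r = (r_1, r_n) ∈ ℝ²` ("`x = (p, q, r) ∈ X = ℝ^{2d(n+1)}`", `d = 1`).
[cite: ReyBelletThomas2002, §2 (effective equations, arXiv (e23))] [cite: ReyBellet2006, §3 eq. (69)] -/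
abbrev RBPhaseSpace (N : ℕ) : Type := PhaseSpace N × (ℝ × ℝ)

/-- `∂_{q_i}` on the extended phase space (freeze `r`, use `partialQ`). [folklore] -/
def rbPartialQ {N : ℕ} (i : Fin N) (f : RBPhaseSpace N → ℝ) (x : RBPhaseSpace N) : ℝ :=
  partialQ i (fun z => f (z, x.2)) x.1

/-- `∂_{p_i}` on the extended phase space (freeze `r`, use `partialP`). [folklore] -/
def rbPartialP {N : ℕ} (i : Fin N) (f : RBPhaseSpace N → ℝ) (x : RBPhaseSpace N) : ℝ :=
  partialP i (fun z => f (z, x.2)) x.1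

/-- `∂_{r_L}`, the derivative along the left auxiliary variable. [folklore] -/
def partialRL {N : ℕ} (f : RBPhaseSpace N → ℝ) (x : RBPhaseSpace N) : ℝ :=
  deriv (fun t => f (x.1, (t, x.2.2))) x.2.1

/-- `∂_{r_R}`, the derivative along the right auxiliary variable. [folklore] -/
def partialRR {N : ℕ} (f : RBPhaseSpace N → ℝ) (x : RBPhaseSpace N) : ℝ :=
  deriv (fun t => f (x.1, (x.2.1, t))) x.2.2

namespace OscillatorChain

variable (P : OscillatorChain)

/-- The **generator of the Rey-Bellet–Thomas effective dynamics** (RBT 2002 §2; RB 2006 eq. (71)) for the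
chain data `P = (U, V, γ)` with `N` sites, coupling constant `Λ = λ` and reservoir temperatures
`T_L` (site `0`) and `T_R` (site `N-1`):
`L f = ∑_i (p_i ∂_{q_i} f - ∂_{q_i}H ∂_{p_i} f) + γ (T_L ∂²_{r_L} f - r_L ∂_{r_L} f + T_R ∂²_{r_R} f - r_R ∂_{r_R} f)`
`      + λ (p_0 ∂_{r_L} f - r_L ∂_{p_0} f) + λ (p_{N-1} ∂_{r_R} f - r_R ∂_{p_{N-1}} f)`,
i.e. `γ(∇_r T ∇_r - r∇_r) + (Λp∇_r - rΛ∇_p) + (p∇_q - ∇_qV ∇_p)`, the generator of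
`q̇ = p`, `ṗ = -∇_qV - Λᵀr`, `dr = (-γr + Λp)dt + (2γT)^{1/2}dω` (RBT-SDE). Here `γ` (the field
`P.γ`) is the decay rate of the reservoir covariance `λ²e^{-γ|t|}` and `Λ` the coupling strength.
[cite: ReyBelletThomas2002, §2 (generator L)] [cite: ReyBellet2006, §3 eq. (71)] -/
def rbGenerator (Λ : ℝ) (N : ℕ) (T_L T_R : ℝ) (f : RBPhaseSpace N → ℝ) (x : RBPhaseSpace N) : ℝ :=
  (∑ i, (x.1.2 i * rbPartialQ i f x - partialQ i (P.hamiltonian N) x.1 * rbPartialP i f x)) +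
    P.γ * (T_L * partialRL (partialRL f) x - x.2.1 * partialRL f x +
      (T_R * partialRR (partialRR f) x - x.2.2 * partialRR f x)) +
    Λ * ∑ i : Fin N,
      ((if i.val = 0 then x.1.2 i * partialRL f x - x.2.1 * rbPartialP i f x else 0) +
        (if i.val = N - 1 then x.1.2 i * partialRR f x - x.2.2 * rbPartialP i f x else 0))

/-- The **energy function** `G(p, q, r) = r²/2 + H(p, q)` of the effective dynamics
(RBT 2002 §2, after the generator). [cite: ReyBelletThomas2002, §2 (energy function G)] [cite: ReyBellet2006, §3 eq. (73)] -/
def rbEnergy (N : ℕ) (x : RBPhaseSpace N) : ℝ :=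
  (x.2.1 ^ 2 + x.2.2 ^ 2) / 2 + P.hamiltonian N x.1

end OscillatorChain

/-! ### Hypotheses H1 (growth at infinity) and H2 (non-degeneracy), `d = 1` -/

/-- **H1 (growth at infinity) for a one-variable potential `W` of (real) degree `k`** (RBT 2002 §1
H1; Rey-Bellet 2006, (64)–(66); powers are real powers `Real.rpow`, `s → +∞`): `W ∈ C^∞` and
there are a leading coefficient `a > 0` and constants
`C, D` with `lim_{s→∞} s^{-k} W(sx) = a|x|^k`, `lim_{s→∞} s^{-k+1} W'(sx) = a k |x|^{k-2} x`, and
`|W''(x)| ≤ (C + D W(x))^{1 - 2/k}` (with `C + D W ≥ 0`) for all `x`.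
[cite: ReyBelletThomas2002, §1 H1] [cite: ReyBellet2006, §3 eqs. (64)–(66)] -/
def RBGrowth (W : ℝ → ℝ) (k : ℝ) : Prop :=
  ContDiff ℝ ∞ W ∧
    ∃ a : ℝ, 0 < a ∧
      (∀ x : ℝ, Tendsto (fun s : ℝ => W (s * x) / s ^ k) atTop (𝓝 (a * |x| ^ k))) ∧
      (∀ x : ℝ, Tendsto (fun s : ℝ => deriv W (s * x) / s ^ (k - 1)) atTop
        (𝓝 (a * k * |x| ^ (k - 2) * x))) ∧
      ∃ C D : ℝ, ∀ x : ℝ, 0 ≤ C + D * W x ∧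
        |iteratedDeriv 2 W x| ≤ (C + D * W x) ^ (1 - 2 / k)

/-- **H2 (non-degeneracy) for the nearest-neighbour potential, `d = 1`** (RBT 2002 §1 H2 with
`d = 1`; Rey-Bellet 2006 §3 H2: "for any `q ∈ ℝ` there exists `m = m(q) ≥ 2` such that
`∂^m U⁽²⁾(q) ≠ 0` … no flat pieces nor infinitely degenerate critical points").
[cite: ReyBelletThomas2002, §1 H2] [cite: ReyBellet2006, §3 H2] -/
def RBNondegenerate (W : ℝ → ℝ) : Prop :=
  ∀ x : ℝ, ∃ m : ℕ, 2 ≤ m ∧ iteratedDeriv m W x ≠ 0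

/-! ### The named facts -/

/-- NAMED FACT — **Rey-Bellet–Thomas 2002, Theorem 2.1** (`d = 1`). "Assume that H1 and H2 hold
[`U⁽¹⁾`, `U⁽²⁾ ∈ C^∞` growing like `|x|^{k_1}`, `|x|^{k_2}` with `k_2 ≥ k_1 ≥ 2`; `U⁽²⁾`
non-degenerate]. The Markov process `x(t)` which solves [(RBT-SDE)] has smooth transition probability
densities, `P_t(x, dy) = p_t(x, y) dy`, with `p_t(x, y) ∈ C^∞((0, ∞) × X × X)`. The Markov process
`x(t)` has a unique invariant measure `μ`, and `μ` has a `C^∞` everywhere positive density. For any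
`θ` with `0 < θ < (max{T_1, T_n})⁻¹` there exist constants `r = r(θ) > 1` and `R = R(θ) < ∞`
such that `‖P_t(x, ·) - μ‖_{exp(θG)} ≤ R r^{-t} exp(θ G(x))` for all `x ∈ X` (exponential
convergence to the SNS), or equivalently `‖T^t - μ‖_θ ≤ R r^{-t}` (spectral gap). Furthermore
for all functions `f, g` with `f², g² ∈ L^∞_θ(X)` and all `t > 0` we have
`|∫ g T^t f dμ - ∫ f dμ ∫ g dμ| ≤ R r^{-t} ‖f²‖_θ^{1/2} ‖g²‖_θ^{1/2}` (exponential decay of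
correlations in the SNS)." Here `‖π‖_W = sup_{|f| ≤ W} |∫ f dπ|`, `‖f‖_θ = sup |f| e^{-θG}`.
Vendored for the chain data `P = (U, V, γ)` (`U⁽¹⁾ = U`, `U⁽²⁾(x) = V(-x)`), real exponents
`2 ≤ k₁ ≤ k₂`, coupling `Λ > 0`, `γ > 0`, `N ≥ 2` sites (as printed: `j = 2, …, n-1`), `T_L, T_R > 0`,
EXISTENTIALLY over the interface `MarkovSemigroupFor`
(the transition semigroup of (RBT-SDE)); "unique invariant measure" among probability measures; the
finiteness of `μ(e^{θG})` and `P_t e^{θG}(x)` implicit in the spectral-gap form is explicit.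
[cite: ReyBelletThomas2002, Thm 2.1] -/
def ReyBelletThomas2002_thm21 : Prop :=
  ∀ (P : OscillatorChain) (Λ : ℝ) (k₁ k₂ : ℝ), 2 ≤ k₁ → k₁ ≤ k₂ →
    RBGrowth P.U k₁ → RBGrowth P.V k₂ → RBNondegenerate P.V → 0 < P.γ → 0 < Λ →
    ∀ (N : ℕ) (T_L T_R : ℝ), 2 ≤ N → 0 < T_L → 0 < T_R →
      ∃ S : MarkovSemigroupFor (P.rbGenerator Λ N T_L T_R),
        -- smooth transition densities `p_t(x, y)`, `C^∞` on `(0, ∞) × X × X`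
        (∃ p : ℝ → RBPhaseSpace N → RBPhaseSpace N → ℝ,
          ContDiffOn ℝ ∞ (fun w : ℝ × RBPhaseSpace N × RBPhaseSpace N => p w.1 w.2.1 w.2.2)
            (Set.Ioi (0 : ℝ) ×ˢ Set.univ) ∧
          ∀ t : ℝ≥0, 0 < t → ∀ x : RBPhaseSpace N,
            S.kernel t x = (volume : Measure (RBPhaseSpace N)).withDensity
              fun y => ENNReal.ofReal (p t x y)) ∧
        -- the unique invariant probability measure, with smooth positive density
        ∃ μ : Measure (RBPhaseSpace N), IsProbabilityMeasure μ ∧ S.IsInvariant μ ∧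
          (∀ ν : Measure (RBPhaseSpace N), IsProbabilityMeasure ν → S.IsInvariant ν → ν = μ) ∧
          HasSmoothPosDensity μ ∧
          -- exponential convergence in the `e^{θG}`-weighted norm, decay of correlations
          ∀ θ : ℝ, 0 < θ → θ < 1 / max T_L T_R →
            Integrable (fun y => Real.exp (θ * P.rbEnergy N y)) μ ∧
            (∀ (t : ℝ≥0) (x : RBPhaseSpace N),
              Integrable (fun y => Real.exp (θ * P.rbEnergy N y)) (S.kernel t x)) ∧
            ∃ r R : ℝ, 1 < r ∧ 0 ≤ R ∧
              (∀ (x : RBPhaseSpace N) (t : ℝ≥0) (f : RBPhaseSpace N → ℝ), Measurable f →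
                (∀ y, |f y| ≤ Real.exp (θ * P.rbEnergy N y)) →
                |S.act t f x - ∫ y, f y ∂μ| ≤
                  R * r ^ (-(t : ℝ)) * Real.exp (θ * P.rbEnergy N x)) ∧
              (∀ (t : ℝ≥0) (f g : RBPhaseSpace N → ℝ) (a b : ℝ), 0 < (t : ℝ) →
                Measurable f → Measurable g →
                (∀ y, f y ^ 2 ≤ a * Real.exp (θ * P.rbEnergy N y)) →
                (∀ y, g y ^ 2 ≤ b * Real.exp (θ * P.rbEnergy N y)) →
                |∫ y, g y * S.act t f y ∂μ - (∫ y, f y ∂μ) * ∫ y, g y ∂μ| ≤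
                  R * r ^ (-(t : ℝ)) * Real.sqrt a * Real.sqrt b)

/-- NAMED FACT — **the Gibbs density is stationary at equilibrium** (RBT 2002, §2, before
Thm 2.1: "A straightforward computation shows that in the special case `T_1 = T_n = T`,
`Z⁻¹ e^{-G(p,q,r)/T}` is an invariant measure for the Markov process `x(t)`"; Rey-Bellet 2006
eq. (75): `L* e^{-βG} = 0`), in the weak (Fokker–Planck) form: for smooth `U, V`, every `N`,
coupling `Λ`, `T > 0` and every `f ∈ C_c^∞`, `∫ (L f)(x) e^{-G(x)/T} dx = 0`. RBT state it under the
standing hypothesis H1 (so that `Z < ∞`); the weak identity itself needs no growth condition (the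
Hamiltonian and coupling vector fields are divergence-free and preserve `G`, the Ornstein–Uhlenbeck
part integrates by parts against `e^{-r²/2T}`), which is Rey-Bellet 2006 eq. (75) `L* e^{-βG} = 0`.
[cite: ReyBelletThomas2002, §2 (before Thm 2.1)] [cite: ReyBellet2006, §3 eq. (75)] -/
def ReyBelletThomas2002_equilibrium : Prop :=
  ∀ (P : OscillatorChain) (Λ : ℝ) (N : ℕ) (T : ℝ), 0 < T → ContDiff ℝ ∞ P.U → ContDiff ℝ ∞ P.V →
    ∀ f : RBPhaseSpace N → ℝ, ContDiff ℝ ∞ f → HasCompactSupport f →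
      ∫ x, P.rbGenerator Λ N T T f x * Real.exp (-(P.rbEnergy N x) / T)
        ∂(volume : Measure (RBPhaseSpace N)) = 0

/-! ### Corollaries of the fact (proved) -/

namespace ReyBelletThomas2002_thm21

/-- Theorem 2.1, uniqueness half in `∃!` form: under H1–H2 there is a Markov semigroup of the
effective dynamics with exactly one invariant probability measure, and it has a smooth positive
density. [cite: ReyBelletThomas2002, Thm 2.1] -/
theorem existsUnique_isInvariant (h : ReyBelletThomas2002_thm21) {P : OscillatorChain} {Λ : ℝ}
    {k₁ k₂ : ℝ} (hk : 2 ≤ k₁) (hkk : k₁ ≤ k₂) (hU : RBGrowth P.U k₁) (hV : RBGrowth P.V k₂)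
    (hV' : RBNondegenerate P.V) (hγ : 0 < P.γ) (hΛ : 0 < Λ) {N : ℕ} (hN : 2 ≤ N) {T_L T_R : ℝ}
    (hL : 0 < T_L) (hR : 0 < T_R) :
    ∃ S : MarkovSemigroupFor (P.rbGenerator Λ N T_L T_R),
      ∃! μ : Measure (RBPhaseSpace N),
        IsProbabilityMeasure μ ∧ S.IsInvariant μ ∧ HasSmoothPosDensity μ := by
  obtain ⟨S, -, μ, hμ, hinv, huniq, hdens, -⟩ :=
    h P Λ k₁ k₂ hk hkk hU hV hV' hγ hΛ N T_L T_R hN hL hR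
  exact ⟨S, μ, ⟨hμ, hinv, hdens⟩, fun ν ⟨hν, hνi, _⟩ => huniq ν hν hνi⟩

/-- Theorem 2.1, convergence half specialised to bounded observables: for `0 < θ < 1/max(T_L,T_R)`
and `G ≥ 0` (fed as a hypothesis) `|P_t f(x) - μ(f)| ≤ R r^{-t} e^{θG(x)}` whenever `|f| ≤ 1`.
[cite: ReyBelletThomas2002, Thm 2.1] [cite: ReyBellet2006, Thm 3.1 eq. (81)] -/
theorem exists_exponential_convergence (h : ReyBelletThomas2002_thm21) {P : OscillatorChain}
    {Λ : ℝ} {k₁ k₂ : ℝ} (hk : 2 ≤ k₁) (hkk : k₁ ≤ k₂) (hU : RBGrowth P.U k₁)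
    (hV : RBGrowth P.V k₂) (hV' : RBNondegenerate P.V) (hγ : 0 < P.γ) (hΛ : 0 < Λ) {N : ℕ}
    (hN : 2 ≤ N) {T_L T_R : ℝ} (hL : 0 < T_L) (hR : 0 < T_R)
    (hG : ∀ x : RBPhaseSpace N, 0 ≤ P.rbEnergy N x) {θ : ℝ} (h0 : 0 < θ)
    (h1 : θ < 1 / max T_L T_R) :
    ∃ S : MarkovSemigroupFor (P.rbGenerator Λ N T_L T_R),
      ∃ μ : Measure (RBPhaseSpace N), IsProbabilityMeasure μ ∧ S.IsInvariant μ ∧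
        ∃ r R : ℝ, 1 < r ∧ 0 ≤ R ∧
          ∀ (x : RBPhaseSpace N) (t : ℝ≥0) (f : RBPhaseSpace N → ℝ), Measurable f →
            (∀ y, |f y| ≤ 1) →
            |S.act t f x - ∫ y, f y ∂μ| ≤ R * r ^ (-(t : ℝ)) * Real.exp (θ * P.rbEnergy N x) := by
  obtain ⟨S, -, μ, hμ, hinv, -, -, hθ⟩ :=
    h P Λ k₁ k₂ hk hkk hU hV hV' hγ hΛ N T_L T_R hN hL hR
  obtain ⟨-, -, r, R, hr, hR0, hconv, -⟩ := hθ θ h0 h1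
  refine ⟨S, μ, hμ, hinv, r, R, hr, hR0, fun x t f hf hf1 => hconv x t f hf fun y => ?_⟩
  exact (hf1 y).trans (Real.one_le_exp (mul_nonneg h0.le (hG y)))

end ReyBelletThomas2002_thm21

/-! ### The quartic potentials of `pinnedChain` satisfy H1 (`k = 4`) and H2 -/

/-- The quartic one-variable potential `c₂ y²/2 + c₄ y⁴/4` (both `pinnedChain` potentials are of
this form). [folklore] -/
def quarticPotential (c₂ c₄ : ℝ) (y : ℝ) : ℝ := c₂ * y ^ 2 / 2 + c₄ * y ^ 4 / 4

/-- `(c₂ y²/2 + c₄ y⁴/4)' = c₂ y + c₄ y³`. [folklore] -/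
theorem hasDerivAt_quarticPotential (c₂ c₄ y : ℝ) :
    HasDerivAt (quarticPotential c₂ c₄) (c₂ * y + c₄ * y ^ 3) y := by
  have h2 : HasDerivAt (fun y : ℝ => c₂ * y ^ 2 / 2) (c₂ * (((2 : ℕ) : ℝ) * y ^ (2 - 1)) / 2) y :=
    ((hasDerivAt_pow 2 y).const_mul c₂).div_const 2
  have h4 : HasDerivAt (fun y : ℝ => c₄ * y ^ 4 / 4) (c₄ * (((4 : ℕ) : ℝ) * y ^ (4 - 1)) / 4) y :=
    ((hasDerivAt_pow 4 y).const_mul c₄).div_const 4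
  refine (h2.add h4).congr_deriv ?_
  push_cast
  ring

/-- `deriv` of the quartic potential. [folklore] -/
theorem deriv_quarticPotential (c₂ c₄ : ℝ) :
    deriv (quarticPotential c₂ c₄) = fun y => c₂ * y + c₄ * y ^ 3 :=
  funext fun y => (hasDerivAt_quarticPotential c₂ c₄ y).deriv

/-- `(c₂ y + c₄ y³)' = c₂ + 3 c₄ y²`. [folklore] -/
theorem hasDerivAt_deriv_quarticPotential (c₂ c₄ y : ℝ) :
    HasDerivAt (deriv (quarticPotential c₂ c₄)) (c₂ + 3 * c₄ * y ^ 2) y := by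
  rw [deriv_quarticPotential]
  have h1 : HasDerivAt (fun y : ℝ => c₂ * y) (c₂ * 1) y := (hasDerivAt_id y).const_mul c₂
  have h3 : HasDerivAt (fun y : ℝ => c₄ * y ^ 3) (c₄ * (((3 : ℕ) : ℝ) * y ^ (3 - 1))) y :=
    (hasDerivAt_pow 3 y).const_mul c₄
  refine (h1.add h3).congr_deriv ?_
  push_cast
  ring

/-- Second derivative of the quartic potential. [folklore] -/
theorem iteratedDeriv_two_quarticPotential (c₂ c₄ y : ℝ) :
    iteratedDeriv 2 (quarticPotential c₂ c₄) y = c₂ + 3 * c₄ * y ^ 2 := by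
  rw [iteratedDeriv_succ, iteratedDeriv_one]
  exact (hasDerivAt_deriv_quarticPotential c₂ c₄ y).deriv

/-- The quartic potential is smooth. [folklore] -/
theorem contDiff_quarticPotential (c₂ c₄ : ℝ) : ContDiff ℝ ∞ (quarticPotential c₂ c₄) := by
  unfold quarticPotential
  exact ((contDiff_const.mul (contDiff_id.pow 2)).div_const 2).add
    ((contDiff_const.mul (contDiff_id.pow 4)).div_const 4)

/-- **H2 for the quartic coupling**: `(c₂ y²/2 + c₄ y⁴/4)'' = c₂ + 3c₄y² > 0` when `c₂ > 0`,
`c₄ ≥ 0`, so `m = 2` works everywhere. [folklore] -/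
theorem rbNondegenerate_quartic {c₂ c₄ : ℝ} (h₂ : 0 < c₂) (h₄ : 0 ≤ c₄) :
    RBNondegenerate (quarticPotential c₂ c₄) := by
  intro y
  refine ⟨2, le_rfl, ?_⟩
  rw [iteratedDeriv_two_quarticPotential]
  positivity

/-- **H1 with `k = 4` for the quartic potential** `c₂ y²/2 + c₄ y⁴/4`, `c₂ ≥ 0`, `c₄ > 0`:
leading coefficient `a = c₄/4`; `s⁻⁴ W(sy) = c₂y²/(2s²) + c₄y⁴/4 → c₄y⁴/4`,
`s⁻³ W'(sy) = c₂y/s² + c₄y³ → c₄ y³ = a·4·|y|²·y`, and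
`W'' = c₂ + 3c₄y² ≤ (c₂² + 36 c₄ W)^{1/2}`. [folklore] -/
theorem rbGrowth_quartic {c₂ c₄ : ℝ} (h₂ : 0 ≤ c₂) (h₄ : 0 < c₄) :
    RBGrowth (quarticPotential c₂ c₄) 4 := by
  refine ⟨contDiff_quarticPotential c₂ c₄, c₄ / 4, by positivity, ?_, ?_, ?_⟩
  · -- (64): `W(sy)/s⁴ → (c₄/4) |y|⁴`
    intro y
    have hlim : Tendsto (fun s : ℝ => c₂ * y ^ 2 / 2 * (s ^ 2)⁻¹ + c₄ / 4 * |y| ^ (4 : ℕ)) atTop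
        (𝓝 (0 + c₄ / 4 * |y| ^ (4 : ℕ))) := by
      refine Tendsto.add ?_ tendsto_const_nhds
      have h := (tendsto_pow_atTop (α := ℝ) two_ne_zero).inv_tendsto_atTop
      simpa using h.const_mul (c₂ * y ^ 2 / 2)
    rw [zero_add] at hlim
    rw [show (4 : ℝ) = ((4 : ℕ) : ℝ) by norm_num, Real.rpow_natCast]
    refine hlim.congr' ?_
    filter_upwards [eventually_gt_atTop (0 : ℝ)] with s hs
    have habs : |y| ^ 4 = y ^ 4 := by
      rw [show (4 : ℕ) = 2 * 2 from rfl, pow_mul, sq_abs, ← pow_mul]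
    rw [Real.rpow_natCast, habs, quarticPotential]
    field_simp
  · -- (65): `W'(sy)/s³ → (c₄/4)·4·|y|²·y`
    intro y
    have hlim : Tendsto (fun s : ℝ => c₂ * y * (s ^ 2)⁻¹ + c₄ * y ^ 3) atTop
        (𝓝 (0 + c₄ * y ^ 3)) := by
      refine Tendsto.add ?_ tendsto_const_nhds
      have h := (tendsto_pow_atTop (α := ℝ) two_ne_zero).inv_tendsto_atTop
      simpa using h.const_mul (c₂ * y)
    rw [zero_add] at hlim
    have htarget : c₄ / 4 * (4 : ℝ) * |y| ^ ((4 : ℝ) - 2) * y = c₄ * y ^ 3 := by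
      rw [show (4 : ℝ) - 2 = 2 by norm_num, Real.rpow_two, sq_abs]
      ring
    rw [htarget]
    refine hlim.congr' ?_
    filter_upwards [eventually_gt_atTop (0 : ℝ)] with s hs
    rw [deriv_quarticPotential]
    simp only
    rw [show (4 : ℝ) - 1 = ((3 : ℕ) : ℝ) by norm_num, Real.rpow_natCast]
    field_simp
  · -- (66): `|W''| ≤ (c₂² + 36 c₄ W)^{1/2}`
    refine ⟨c₂ ^ 2, 36 * c₄, fun y => ?_⟩
    have hW : 0 ≤ quarticPotential c₂ c₄ y := by
      unfold quarticPotential; positivity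
    have hbase : 0 ≤ c₂ ^ 2 + 36 * c₄ * quarticPotential c₂ c₄ y := by positivity
    refine ⟨hbase, ?_⟩
    rw [iteratedDeriv_two_quarticPotential, abs_of_nonneg (by positivity),
      show (1 - 2 / 4 : ℝ) = 1 / 2 by norm_num, ← Real.sqrt_eq_rpow,
      Real.le_sqrt (by positivity) hbase]
    unfold quarticPotential
    nlinarith [sq_nonneg y, sq_nonneg (c₄ * y ^ 2), mul_nonneg h₂ h₄.le,
      mul_nonneg (mul_nonneg h₂ h₄.le) (sq_nonneg y)]

/-- The potentials of `pinnedChain ω₂ lam β γ` are the quartic potentials `quarticPotential ω₂ lam`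
(pinning) and `quarticPotential 1 β` (coupling). [folklore] -/
theorem pinnedChain_U_eq (ω₂ lam β γ : ℝ) : (pinnedChain ω₂ lam β γ).U = quarticPotential ω₂ lam := by
  funext y; simp [pinnedChain, quarticPotential]

/-- See `pinnedChain_U_eq`. [folklore] -/
theorem pinnedChain_V_eq (ω₂ lam β γ : ℝ) : (pinnedChain ω₂ lam β γ).V = quarticPotential 1 β := by
  funext y; simp [pinnedChain, quarticPotential]

/-- **Corollary for the conjunct's chain.** Under the fact `ReyBelletThomas2002_thm21`, the pinned
anharmonic chain `pinnedChain ω₂ lam β γ` (`ω₂ ≥ 0`, `lam, β, γ > 0`; H1 with `k₁ = k₂ = 4`, H2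
with `m = 2`) with `N ≥ 2` sites, coupled with strength `Λ > 0` to two Rey-Bellet–Thomas free-phonon
reservoirs at temperatures `T_L, T_R > 0`, has a Markov semigroup with exactly one invariant
probability measure, which has a smooth everywhere positive density.
[cite: ReyBelletThomas2002, Thm 2.1] -/
theorem ReyBelletThomas2002_thm21.pinnedChain (h : ReyBelletThomas2002_thm21) {ω₂ lam β γ Λ : ℝ}
    (hω : 0 ≤ ω₂) (hl : 0 < lam) (hβ : 0 < β) (hγ : 0 < γ) (hΛ : 0 < Λ) {N : ℕ} (hN : 2 ≤ N)
    {T_L T_R : ℝ} (hL : 0 < T_L) (hR : 0 < T_R) :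
    ∃ S : MarkovSemigroupFor ((pinnedChain ω₂ lam β γ).rbGenerator Λ N T_L T_R),
      ∃! μ : Measure (RBPhaseSpace N),
        IsProbabilityMeasure μ ∧ S.IsInvariant μ ∧ HasSmoothPosDensity μ := by
  refine h.existsUnique_isInvariant (k₁ := 4) (k₂ := 4) (by norm_num) le_rfl ?_ ?_ ?_ hγ hΛ hN hL hR
  · rw [pinnedChain_U_eq]; exact rbGrowth_quartic hω hl
  · rw [pinnedChain_V_eq]; exact rbGrowth_quartic zero_le_one hβ
  · rw [pinnedChain_V_eq]; exact rbNondegenerate_quartic one_pos hβ.le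

/-- The energy `G` of the pinned chain is nonnegative for `ω₂, lam, β ≥ 0` (so the bounded-
observable corollary `exists_exponential_convergence` applies to it). [folklore] -/
theorem pinnedChain_rbEnergy_nonneg {ω₂ lam β : ℝ} (hω : 0 ≤ ω₂) (hl : 0 ≤ lam) (hβ : 0 ≤ β)
    (γ : ℝ) (N : ℕ) (x : RBPhaseSpace N) : 0 ≤ (pinnedChain ω₂ lam β γ).rbEnergy N x := by
  unfold OscillatorChain.rbEnergy OscillatorChain.hamiltonian pinnedChain
  refine add_nonneg (by positivity) (add_nonneg (Finset.sum_nonneg fun i _ => ?_)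
    (Finset.sum_nonneg fun i _ => Finset.sum_nonneg fun j _ => ?_))
  · positivity
  · split_ifs
    · positivity
    · exact le_rfl

/-! ### Elementary API of the model -/

namespace OscillatorChain

variable (P : OscillatorChain)

/-- The RBT generator annihilates constants (`L 1 = 0`). [folklore] -/
@[simp] theorem rbGenerator_const (Λ : ℝ) (N : ℕ) (T_L T_R c : ℝ) (x : RBPhaseSpace N) :
    P.rbGenerator Λ N T_L T_R (fun _ => c) x = 0 := by
  simp [rbGenerator, rbPartialQ, rbPartialP, partialRL, partialRR, partialQ, partialP]

/-- The energy splits as reservoir part plus chain Hamiltonian. [folklore] -/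
theorem rbEnergy_apply (N : ℕ) (z : PhaseSpace N) (r : ℝ × ℝ) :
    P.rbEnergy N (z, r) = (r.1 ^ 2 + r.2 ^ 2) / 2 + P.hamiltonian N z := rfl

end OscillatorChain

end Literature.MathematicalPhysics.KineticTheory.HeatConduction
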